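import Summits.QuantumFields.YangMills.Theorems.F4SubCurvatureDoorShortRootRigidityPlanarApertureStepPrelims
import Summits.QuantumFields.YangMills.Theorems.F4SubCurvatureDoorShortRootRigidityFlatDoubleEdge
import Summits.QuantumFields.YangMills.Theorems.F4SubCurvatureDoorShortRootRigidityPlanarConeSupport
import Summits.QuantumFields.YangMills.Theorems.F4SubCurvatureDoorRationalToGeneralPringsheimCore
import Mathlib
import HarnessLib

/-!
# LINE g21-C «aperture bootstrap» (crux ⟨stmt-QuantumFields-23035⟩ `ShortRootRigidity`) — registered stub `:137`
# `stub_planarApertureStep : FlatDoubleEdge → PlanarApertureStep` (R-S3d, THE STEP) BY NAME AND SIGNATURE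

Owner STUB-PLAN `Cruxes/ShortRootRigidity/Lines/aperture_bootstrap_stubplans.md` (planner ym-idea-3 g21, sha16 a045f2eb0c54f2ce), H4–H10, on top of
H1–H3 (`…PlanarFrameGluing`, this seat).  Fix `0 < τ < 1`, `t ≥ 1`, the shift `ε = 1`.

* H4 the shifted frame functions `G₀(z) = F₀(z + (1,0))`, `Gp(z) = F₊(z + (1,0))` are bounded by `M := ∫ e^{−E/2} dμ` on `T₀(τ)`, `T₊(τ)`;
* H5 edge geometry at `z⋆ = (t, iτt)`, radius `r = τt/3` (max norm): the functionals `l₀ = (iτ, −1)`, `l₊ = (√3/2 + iτ/2, −1/2 + iτ√3/2)` are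
  ℂ-independent (`det = (√3/2)(1 − τ²)`), and `{Im l₀(z − z⋆) > 0} ∩ B(z⋆, r) ⊂ T₀`, `{Im l₊(z − z⋆) > 0} ∩ B(z⋆, r) ⊂ T₊`;
* H6 `FlatDoubleEdge` (hypothesis, BY NAME — landed as `:128`) applied to the glued `f` gives `g` holomorphic on `B(z⋆, δ₁r)`, `‖g‖ ≤ M`;
* H7–H8 on the line `ζ = t` the function `Φ` (strip `|Im β| < τt` ∪ two discs of radius `ρ = δ₁τt/3` at `±iτt`) is holomorphic and bounded by `M`
  on the disc `|β| < R`, `R = (τ + δ″)t`, `δ″ = δ₁²τ/72`, with real trace `s ↦ ∫ e^{−(t+1)E} cos(sp) dμ`;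
* H9 the one-dimensional Pringsheim step `…PringsheimCore.cosh_integral_le_of_holomorphic` (this seat, p719524) on the `p`-marginal of
  `e^{−(t+1)E}μ` gives `∫ e^{−(t+1)E} cosh((τ + δ″/2)t·p) dμ ≤ M` for every `t ≥ 1`;
* H10 pinning with an energy cap turns this into `HasAperture μ (τ + δ″/2)`.

HONEST LABEL: a registered stub of an OPEN line; with `:128 ✓`, `:132 ✓`, this `:137` and w3's `:141`, the line's remaining open stub is the shared
`stub_oddModeRigidity`; (C)'s support form becomes a theorem, but ⟨23035⟩, ⟨23125⟩, R2d and the Yang–Mills mass gap remain OPEN here; no summit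
is proved by a line.  Lead seat `ym-line-sfw-p2` g75 (cell ym-idea-1, free hands).
-/

set_option autoImplicit false

noncomputable section

open MeasureTheory Filter Topology Set Metric Complex
open scoped BigOperators ENNReal NNReal

namespace Summit.QuantumFields.YangMills.Theorems.F4SubCurvatureDoorPlanarApertureStepByName

open Summit.QuantumFields.YangMills.Theorems.F4SubCurvatureDoorSliceDensityRegistered (E2)
open Summit.QuantumFields.YangMills.Theorems.F4SubCurvatureDoorSliceInClassRegistered (InPlanarClass)
open Summit.QuantumFields.YangMills.Cruxes.ShortRootRigidity.AngularType (mk2)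
open Summit.QuantumFields.YangMills.Theorems.F4SubCurvatureDoorPlanarFrameGluing
open Summit.QuantumFields.YangMills.Theorems.F4SubCurvatureDoorFlatDoubleEdgeRegistered (FlatDoubleEdge)
open Summit.QuantumFields.YangMills.Theorems.F4SubCurvatureDoorPlanarInitialApertureRegistered (IsPlanarLF HasAperture)
open Summit.QuantumFields.YangMills.Theorems.F4SubCurvatureDoorPlanarConeSupportRegistered (PlanarApertureStep)
open Summit.QuantumFields.YangMills.Theorems.F4SubCurvatureDoorPringsheimCore (cosh_integral_le_of_holomorphic)

open Summit.QuantumFields.YangMills.Theorems.F4SubCurvatureDoorPlanarApertureStepPrelims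

/-! ## D. The step -/

section Step

variable {μ : Measure (ℝ × ℝ)} {τ : ℝ} {k : E2 → ℝ}

/-- `F₀` is even in `β` (`cos` is even). -/
theorem F0_neg_snd (μ : Measure (ℝ × ℝ)) (ζ β : ℂ) : F0 μ (ζ, -β) = F0 μ (ζ, β) := by
  simp only [F0, neg_mul, Complex.cos_neg]

/-- The axis function `L(s) = ∫ e^{−sE} dμ` is antitone on `(0, ∞)`. -/
theorem axis_antitone (hμ0 : μ (Iio 0 ×ˢ univ) = 0)
    (hint : ∀ s : ℝ, 0 < s → Integrable (fun z : ℝ × ℝ => Real.exp (-(s * z.1))) μ) {s s' : ℝ} (hs : 0 < s) (hss' : s ≤ s') :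
    ∫ z : ℝ × ℝ, Real.exp (-(s' * z.1)) ∂μ ≤ ∫ z : ℝ × ℝ, Real.exp (-(s * z.1)) ∂μ := by
  refine integral_mono_ae (hint s' (lt_of_lt_of_le hs hss')) (hint s hs) ?_
  filter_upwards [Summit.QuantumFields.YangMills.Theorems.F4SubCurvatureDoorPlanarLaplaceFourier.ae_energy_nonneg hμ0] with z hz
  exact Real.exp_le_exp.2 (by nlinarith)

/-- **THE CORE OF THE STEP (H4–H9)**: for `t ≥ 1`, the exponential moment of aperture `(τ + δ₁²τ/144)t` of `e^{−(t+1)E}μ` is bounded by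
`M = ∫ e^{−E/2} dμ`, where `δ₁ ≤ 1` is (at most) the `FlatDoubleEdge` constant of `(l₀, l₊)`. -/
theorem cosh_moment_step (hτ0 : 0 < τ) (hτ1 : τ < 1) {δ₁ : ℝ} (hδ₁ : 0 < δ₁) (hδ₁1 : δ₁ ≤ 1)
    (hedge : ∀ (p : ℂ × ℂ) (r : ℝ), 0 < r → ∀ (f : ℂ × ℂ → ℂ) (M : ℝ),
      DifferentiableOn ℂ f {z : ℂ × ℂ | ‖z - p‖ < r ∧ (0 < (l0 τ (z - p)).im ∨ 0 < (lp τ (z - p)).im)} →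
      (∀ z : ℂ × ℂ, ‖z - p‖ < r → (0 < (l0 τ (z - p)).im ∨ 0 < (lp τ (z - p)).im) → ‖f z‖ ≤ M) →
      ∃ g : ℂ × ℂ → ℂ, DifferentiableOn ℂ g (Metric.ball p (δ₁ * r)) ∧ (∀ z ∈ Metric.ball p (δ₁ * r), ‖g z‖ ≤ M) ∧
        ∀ z ∈ Metric.ball p (δ₁ * r), (0 < (l0 τ (z - p)).im ∨ 0 < (lp τ (z - p)).im) → g z = f z)
    (hk : InPlanarClass k) (hμ0 : μ (Iio 0 ×ˢ univ) = 0)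
    (hint : ∀ s : ℝ, 0 < s → Integrable (fun z : ℝ × ℝ => Real.exp (-(s * z.1))) μ)
    (hrep : ∀ t : ℝ, 0 < t → ∀ x : ℝ, k (mk2 t x) = ∫ z, Real.exp (-(z.1 * t)) * Real.cos (z.2 * x) ∂μ)
    (hap : μ {z : ℝ × ℝ | z.1 < τ * |z.2|} = 0) {t : ℝ} (ht : 1 ≤ t) :
    Integrable (fun z : ℝ × ℝ => Real.exp (-((t + 1) * z.1)) * Real.cosh ((τ + δ₁ ^ 2 * τ / 144) * t * z.2)) μ ∧
      ∫ z : ℝ × ℝ, Real.exp (-((t + 1) * z.1)) * Real.cosh ((τ + δ₁ ^ 2 * τ / 144) * t * z.2) ∂μ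
        ≤ ∫ z : ℝ × ℝ, Real.exp (-((1 / 2) * z.1)) ∂μ := by
  have ht0 : 0 < t := by linarith
  have hτt : 0 < τ * t := by positivity
  set M : ℝ := ∫ z : ℝ × ℝ, Real.exp (-((1 / 2) * z.1)) ∂μ with hM
  -- the axis function
  have hL : ∀ s : ℝ, 1 / 2 ≤ s → ∫ z : ℝ × ℝ, Real.exp (-(s * z.1)) ∂μ ≤ M := fun s hs =>
    axis_antitone hμ0 hint (by norm_num) hs
  have hF0d := differentiableOn_F0 hτ0 hμ0 hap hint
  have hFpd := differentiableOn_Fplus hτ0 hμ0 hap hint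
  have hglue := F0_eq_Fplus hτ0 hμ0 hap hint hk hrep
  -- H4: the shifted frame functions
  set e₁ : ℂ × ℂ := ((1 : ℂ), (0 : ℂ)) with he₁
  set G₀ : ℂ × ℂ → ℂ := fun z => F0 μ (z + e₁) with hG₀
  set Gp : ℂ × ℂ → ℂ := fun z => Fplus μ (z + e₁) with hGp
  have hshift₀ : ∀ z ∈ tube τ, z + e₁ ∈ tube τ := by
    intro z hz
    have hz' : |z.2.im| < τ * z.1.re := hz
    show |(z + e₁).2.im| < τ * (z + e₁).1.re
    simp only [he₁, Prod.snd_add, Prod.fst_add, Complex.add_re, add_zero, Complex.one_re]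
    nlinarith
  have hshiftp : ∀ z ∈ tubePlus τ, z + e₁ ∈ tubePlus τ := by
    intro z hz
    have hz' : |(Lplus z).2.im| < τ * (Lplus z).1.re := hz
    show |(Lplus (z + e₁)).2.im| < τ * (Lplus (z + e₁)).1.re
    rw [Lplus_add]
    have h1 : (Lplus e₁).1.re = 1 / 2 := by rw [he₁, Lplus_fst_re]; simp
    have h2 : (Lplus e₁).2.im = 0 := by rw [he₁, Lplus_snd_im]; simp
    simp only [Prod.snd_add, Prod.fst_add, Complex.add_im, Complex.add_re, h1, h2, add_zero]
    nlinarith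
  have hG₀d : DifferentiableOn ℂ G₀ (tube τ) :=
    hF0d.comp (differentiable_id.add (differentiable_const _)).differentiableOn hshift₀
  have hGpd : DifferentiableOn ℂ Gp (tubePlus τ) :=
    hFpd.comp (differentiable_id.add (differentiable_const _)).differentiableOn hshiftp
  have hG₀M : ∀ z ∈ tube τ, ‖G₀ z‖ ≤ M := by
    intro z hz
    have hz' : |z.2.im| < τ * z.1.re := hz
    have hmem := hshift₀ z hz
    refine (norm_F0_le hτ0 hμ0 hap hint hmem).trans (hL _ ?_)
    simp only [he₁, Prod.snd_add, Prod.fst_add, Complex.add_re, add_zero, Complex.one_re]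
    have : |z.2.im| / τ < z.1.re := by rw [div_lt_iff₀ hτ0]; linarith
    linarith
  have hGpM : ∀ z ∈ tubePlus τ, ‖Gp z‖ ≤ M := by
    intro z hz
    have hz' : |(Lplus z).2.im| < τ * (Lplus z).1.re := hz
    have hmem : Lplus (z + e₁) ∈ tube τ := hshiftp z hz
    have h1 : (Lplus e₁).1.re = 1 / 2 := by rw [he₁, Lplus_fst_re]; simp
    have h2 : (Lplus e₁).2.im = 0 := by rw [he₁, Lplus_snd_im]; simp
    show ‖F0 μ (Lplus (z + e₁))‖ ≤ M
    refine (norm_F0_le hτ0 hμ0 hap hint hmem).trans (hL _ ?_)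
    rw [Lplus_add]
    simp only [Prod.snd_add, Prod.fst_add, Complex.add_im, Complex.add_re, h1, h2, add_zero]
    have : |(Lplus z).2.im| / τ < (Lplus z).1.re := by rw [div_lt_iff₀ hτ0]; linarith
    linarith
  have hG₀Gp : ∀ z ∈ tube τ ∩ tubePlus τ, G₀ z = Gp z := fun z hz =>
    hglue ⟨hshift₀ z hz.1, hshiftp z hz.2⟩
  -- H5/H6: the edge
  set zs := zstar τ t with hzs
  set r : ℝ := τ * t / 3 with hr
  have hr0 : 0 < r := by positivity
  set f : ℂ × ℂ → ℂ := fun z => if 0 < (l0 τ (z - zs)).im then G₀ z else Gp z with hf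
  have hmem₀ : ∀ z : ℂ × ℂ, ‖z - zs‖ < r → 0 < (l0 τ (z - zs)).im → z ∈ tube τ := fun z hz h =>
    mem_tube_of_im_l0_pos hτ0 ht hz h
  have hmemp : ∀ z : ℂ × ℂ, ‖z - zs‖ < r → 0 < (lp τ (z - zs)).im → z ∈ tubePlus τ := fun z hz h =>
    mem_tubePlus_of_im_lp_pos hτ0 ht hz h
  have hcont_l0 : Continuous fun z : ℂ × ℂ => (l0 τ (z - zs)).im :=
    Complex.continuous_im.comp ((l0 τ).continuous.comp (continuous_id.sub continuous_const))
  have hcont_lp : Continuous fun z : ℂ × ℂ => (lp τ (z - zs)).im :=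
    Complex.continuous_im.comp ((lp τ).continuous.comp (continuous_id.sub continuous_const))
  have hcont_n : Continuous fun z : ℂ × ℂ => ‖z - zs‖ := continuous_norm.comp (continuous_id.sub continuous_const)
  have hfd : DifferentiableOn ℂ f {z : ℂ × ℂ | ‖z - zs‖ < r ∧ (0 < (l0 τ (z - zs)).im ∨ 0 < (lp τ (z - zs)).im)} := by
    intro z hz
    obtain ⟨hzr, hor⟩ := hz
    by_cases h0 : 0 < (l0 τ (z - zs)).im
    · -- near `z`, `f = G₀`
      have hev : f =ᶠ[𝓝 z] G₀ := by
        filter_upwards [(isOpen_lt continuous_const hcont_l0).mem_nhds h0] with z' hz'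
        simp only [hf, if_pos (show 0 < (l0 τ (z' - zs)).im from hz')]
      have hd : DifferentiableAt ℂ G₀ z := hG₀d.differentiableAt ((isOpen_tube τ).mem_nhds (hmem₀ z hzr h0))
      exact (hev.differentiableAt_iff.2 hd).differentiableWithinAt
    · have hp : 0 < (lp τ (z - zs)).im := hor.resolve_left h0
      have hev : f =ᶠ[𝓝 z] Gp := by
        filter_upwards [(isOpen_lt continuous_const hcont_lp).mem_nhds hp, (isOpen_lt hcont_n continuous_const).mem_nhds hzr]
          with z' hz' hz'r
        by_cases h0' : 0 < (l0 τ (z' - zs)).im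
        · simp only [hf, if_pos h0']
          exact hG₀Gp z' ⟨hmem₀ z' hz'r h0', hmemp z' hz'r hz'⟩
        · simp only [hf, if_neg h0']
      have hd : DifferentiableAt ℂ Gp z := hGpd.differentiableAt ((isOpen_tubePlus τ).mem_nhds (hmemp z hzr hp))
      exact (hev.differentiableAt_iff.2 hd).differentiableWithinAt
  have hfM : ∀ z : ℂ × ℂ, ‖z - zs‖ < r → (0 < (l0 τ (z - zs)).im ∨ 0 < (lp τ (z - zs)).im) → ‖f z‖ ≤ M := by
    intro z hzr hor
    by_cases h0 : 0 < (l0 τ (z - zs)).im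
    · simp only [hf, if_pos h0]; exact hG₀M z (hmem₀ z hzr h0)
    · simp only [hf, if_neg h0]; exact hGpM z (hmemp z hzr (hor.resolve_left h0))
  obtain ⟨g, hgd, hgM, hgf⟩ := hedge zs r hr0 f M hfd hfM
  set ρ : ℝ := δ₁ * r with hρ
  have hρ0 : 0 < ρ := by positivity
  have hρτ : ρ ≤ τ * t / 3 := by rw [hρ, hr]; exact mul_le_of_le_one_left (by positivity) hδ₁1
  -- (A1) on the upper disc, below the line `Im β = τt`, `G₀(t, β) = g(t, β)`
  have hdist : ∀ β : ℂ, ‖((t : ℂ), β) - zs‖ = ‖β - I * ((τ * t : ℝ) : ℂ)‖ := by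
    intro β
    rw [hzs, zstar, Prod.norm_def]
    simp
  have hA1 : ∀ β : ℂ, ‖β - I * ((τ * t : ℝ) : ℂ)‖ < ρ → β.im < τ * t → g ((t : ℂ), β) = G₀ ((t : ℂ), β) := by
    intro β hβ hβim
    have hmem : ((t : ℂ), β) ∈ Metric.ball zs (δ₁ * r) := by
      rw [Metric.mem_ball, dist_eq_norm, hdist]; exact hβ
    have hl0 : 0 < (l0 τ (((t : ℂ), β) - zs)).im := by
      rw [im_l0, hzs, zstar]; simp; linarith
    rw [hgf _ hmem (Or.inl hl0)]
    simp only [hf, if_pos hl0]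
  -- H7: the one-variable function on the line `ζ = t`
  set Φ : ℂ → ℂ := fun β => if |β.im| < τ * t then G₀ ((t : ℂ), β)
    else if 0 < β.im then g ((t : ℂ), β) else g ((t : ℂ), -β) with hΦ
  have hstrip_mem : ∀ β : ℂ, |β.im| < τ * t → ((t : ℂ), β) ∈ tube τ := by
    intro β hβ
    show |β.im| < τ * (t : ℂ).re
    simpa using hβ
  -- `Φ = g(t, ·)` on the upper disc
  have hΦup : ∀ β : ℂ, ‖β - I * ((τ * t : ℝ) : ℂ)‖ < ρ → Φ β = g ((t : ℂ), β) := by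
    intro β hβ
    by_cases h1 : |β.im| < τ * t
    · simp only [hΦ, if_pos h1]
      exact (hA1 β hβ (abs_lt.1 h1).2).symm
    · have him : τ * t - ρ < β.im := by
        have := (Complex.abs_im_le_norm (β - I * ((τ * t : ℝ) : ℂ))).trans_lt hβ
        simp at this
        rw [abs_lt] at this; linarith
      have hpos : 0 < β.im := by linarith
      simp only [hΦ, if_neg h1, if_pos hpos]
  -- `Φ = g(t, −·)` on the lower disc
  have hΦdown : ∀ β : ℂ, ‖-β - I * ((τ * t : ℝ) : ℂ)‖ < ρ → Φ β = g ((t : ℂ), -β) := by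
    intro β hβ
    have him : τ * t - ρ < (-β).im := by
      have := (Complex.abs_im_le_norm (-β - I * ((τ * t : ℝ) : ℂ))).trans_lt hβ
      simp at this
      rw [abs_lt] at this; simp; linarith
    by_cases h1 : |β.im| < τ * t
    · simp only [hΦ, if_pos h1]
      have h1' : (-β).im < τ * t := by simp; rw [abs_lt] at h1; linarith
      have heven : G₀ ((t : ℂ), β) = G₀ ((t : ℂ), -β) := by
        simp only [hG₀, he₁, Prod.mk_add_mk, add_zero]
        rw [F0_neg_snd]
      rw [heven]
      exact (hA1 (-β) hβ h1').symm
    · have hneg : ¬ 0 < β.im := by simp at him; linarith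
      simp only [hΦ, if_neg h1, if_neg hneg]
  set R : ℝ := (τ + δ₁ ^ 2 * τ / 72) * t with hR
  have hRpos : 0 < R := by positivity
  -- H8: the disc `|β| < R` is covered by the strip and the two small discs
  have hcover : ∀ β : ℂ, ‖β‖ < R → |β.im| < τ * t ∨ ‖β - I * ((τ * t : ℝ) : ℂ)‖ < ρ ∨ ‖-β - I * ((τ * t : ℝ) : ℂ)‖ < ρ := by
    intro β hβ
    by_cases h1 : |β.im| < τ * t
    · exact Or.inl h1
    · rw [not_lt] at h1
      rcases le_or_gt 0 β.im with hpos | hneg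
      · right; left
        rw [abs_of_nonneg hpos] at h1
        exact disc_fits hτ0 hτ1 ht hδ₁ hδ₁1 hβ h1
      · right; right
        rw [abs_of_neg hneg] at h1
        have : τ * t ≤ (-β).im := by simp; linarith
        exact disc_fits hτ0 hτ1 ht hδ₁ hδ₁1 (by rwa [norm_neg]) this
  have hgd' : ∀ β : ℂ, ‖β - I * ((τ * t : ℝ) : ℂ)‖ < ρ → DifferentiableAt ℂ (fun β : ℂ => g ((t : ℂ), β)) β := by
    intro β hβ
    have hmem : ((t : ℂ), β) ∈ Metric.ball zs (δ₁ * r) := by rw [Metric.mem_ball, dist_eq_norm, hdist]; exact hβ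
    exact (hgd.differentiableAt (Metric.isOpen_ball.mem_nhds hmem)).comp β
      ((differentiableAt_const _).prodMk differentiableAt_id)
  have hΦd : DifferentiableOn ℂ Φ (Metric.ball 0 R) := by
    intro β hβ
    rw [mem_ball_zero_iff] at hβ
    refine DifferentiableAt.differentiableWithinAt ?_
    rcases hcover β hβ with h1 | h2 | h3
    · have hev : Φ =ᶠ[𝓝 β] fun β => G₀ ((t : ℂ), β) := by
        filter_upwards [(isOpen_lt (continuous_abs.comp Complex.continuous_im) continuous_const).mem_nhds h1] with β' hβ'
        simp only [hΦ, if_pos (show |β'.im| < τ * t from hβ')]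
      refine hev.differentiableAt_iff.2 ?_
      exact (hG₀d.differentiableAt ((isOpen_tube τ).mem_nhds (hstrip_mem β h1))).comp β
        ((differentiableAt_const _).prodMk differentiableAt_id)
    · have hev : Φ =ᶠ[𝓝 β] fun β => g ((t : ℂ), β) := by
        filter_upwards [(isOpen_lt (continuous_norm.comp (continuous_id.sub continuous_const)) continuous_const).mem_nhds h2]
          with β' hβ'
        exact hΦup β' hβ'
      exact hev.differentiableAt_iff.2 (hgd' β h2)
    · have hev : Φ =ᶠ[𝓝 β] fun β => g ((t : ℂ), -β) := by
        filter_upwards [(isOpen_lt (continuous_norm.comp (continuous_neg.sub continuous_const)) continuous_const).mem_nhds h3]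
          with β' hβ'
        exact hΦdown β' hβ'
      refine hev.differentiableAt_iff.2 ?_
      have := hgd' (-β) h3
      exact this.comp β differentiable_neg.differentiableAt
  have hΦM : ∀ β ∈ Metric.ball (0 : ℂ) R, ‖Φ β‖ ≤ M := by
    intro β hβ
    rw [mem_ball_zero_iff] at hβ
    rcases hcover β hβ with h1 | h2 | h3
    · simp only [hΦ, if_pos h1]; exact hG₀M _ (hstrip_mem β h1)
    · rw [hΦup β h2]
      exact hgM _ (by rw [Metric.mem_ball, dist_eq_norm, hdist]; exact h2)
    · rw [hΦdown β h3]
      exact hgM _ (by rw [Metric.mem_ball, dist_eq_norm, hdist]; exact h3)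
  -- the real trace of `Φ` is the cosine transform of the `p`-marginal `m` of `e^{−(t+1)E}μ`
  set m := marg2 μ (t + 1) with hm
  haveI : IsFiniteMeasure m := isFiniteMeasure_marg2 μ (t + 1) (hint _ (by linarith))
  have hΦreal : ∀ s : ℝ, |s| < R → Φ (s : ℂ) = ((∫ q : ℝ, Real.cos (s * q) ∂m : ℝ) : ℂ) := by
    intro s _
    have h1 : |(s : ℂ).im| < τ * t := by simpa using hτt
    simp only [hΦ, if_pos h1, hG₀, he₁]
    rw [hm, integral_marg2 μ (t + 1) (by fun_prop : Continuous fun q : ℝ => Real.cos (s * q))]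
    have e2 : (((t : ℂ), (s : ℂ)) + ((1 : ℂ), (0 : ℂ)) : ℂ × ℂ) = ((((t + 1 : ℝ)) : ℂ), (s : ℂ)) := by
      ext <;> simp
    rw [e2, F0_ofReal hrep (by linarith : 0 < t + 1) s, hrep (t + 1) (by linarith) s]
    congr 1
    refine integral_congr_ae (ae_of_all _ fun z => ?_)
    ring_nf
  -- an initial exponential moment of `m` from the support
  have hexp : Integrable (fun q : ℝ => Real.exp (τ * (t + 1) / 2 * |q|)) m := by
    rw [hm, integrable_marg2_iff μ (t + 1) (by fun_prop : Continuous fun q : ℝ => Real.exp (τ * (t + 1) / 2 * |q|))]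
    refine (hint ((t + 1) / 2) (by linarith)).mono' (by fun_prop) ?_
    filter_upwards [ae_support hμ0 hap] with z hz
    rw [Real.norm_eq_abs, abs_of_pos (by positivity), ← Real.exp_add]
    refine Real.exp_le_exp.2 ?_
    have : τ * |z.2| ≤ z.1 := hz.2
    nlinarith
  -- H9: the Pringsheim step on the disc `|β| < R`
  set δ : ℝ := (τ + δ₁ ^ 2 * τ / 144) * t with hδ
  have hδ0 : 0 < δ := by positivity
  have hδR : δ < R := by rw [hδ, hR]; nlinarith [mul_pos (mul_pos (pow_pos hδ₁ 2) hτ0) ht0]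
  obtain ⟨hIcosh, hle⟩ := cosh_integral_le_of_holomorphic hRpos Φ hΦd hΦM hΦreal (by positivity : 0 < τ * (t + 1) / 2)
    hexp hδ0 hδR
  have hcont : Continuous fun q : ℝ => Real.cosh (δ * q) := by fun_prop
  rw [hm, integrable_marg2_iff μ (t + 1) hcont] at hIcosh
  rw [hm, integral_marg2 μ (t + 1) hcont] at hle
  exact ⟨hIcosh, hle⟩

end Step

/-! ## E. The registered stub, BY NAME AND SIGNATURE -/

/-- **Registered stub `:137` of LINE g21-C (R-S3d, THE STEP): `FlatDoubleEdge → PlanarApertureStep`**, with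
`τ' = τ + δ₁²τ/144`, `δ₁ = min δ₁(l₀, l₊) 1`. -/
theorem stub_planarApertureStep : FlatDoubleEdge → PlanarApertureStep := by
  intro hFDE τ hτ0 hτ1
  obtain ⟨δ₁', hδ₁', hedge'⟩ := hFDE (l0 τ) (lp τ) (linearIndependent_l0_lp hτ0 hτ1)
  set δ₁ : ℝ := min δ₁' 1 with hδ₁def
  have hδ₁ : 0 < δ₁ := lt_min hδ₁' one_pos
  have hδ₁1 : δ₁ ≤ 1 := min_le_right _ _
  have hδ₁le : δ₁ ≤ δ₁' := min_le_left _ _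
  -- the edge statement with the smaller constant `δ₁`
  have hedge : ∀ (p : ℂ × ℂ) (r : ℝ), 0 < r → ∀ (f : ℂ × ℂ → ℂ) (M : ℝ),
      DifferentiableOn ℂ f {z : ℂ × ℂ | ‖z - p‖ < r ∧ (0 < (l0 τ (z - p)).im ∨ 0 < (lp τ (z - p)).im)} →
      (∀ z : ℂ × ℂ, ‖z - p‖ < r → (0 < (l0 τ (z - p)).im ∨ 0 < (lp τ (z - p)).im) → ‖f z‖ ≤ M) →
      ∃ g : ℂ × ℂ → ℂ, DifferentiableOn ℂ g (Metric.ball p (δ₁ * r)) ∧ (∀ z ∈ Metric.ball p (δ₁ * r), ‖g z‖ ≤ M) ∧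
        ∀ z ∈ Metric.ball p (δ₁ * r), (0 < (l0 τ (z - p)).im ∨ 0 < (lp τ (z - p)).im) → g z = f z := by
    intro p r hr f M hf hM
    obtain ⟨g, hgd, hgM, hgf⟩ := hedge' p r hr f M hf hM
    have hsub : Metric.ball p (δ₁ * r) ⊆ Metric.ball p (δ₁' * r) :=
      Metric.ball_subset_ball (mul_le_mul_of_nonneg_right hδ₁le hr.le)
    exact ⟨g, hgd.mono hsub, fun z hz => hgM z (hsub hz), fun z hz h => hgf z (hsub hz) h⟩
  refine ⟨τ + δ₁ ^ 2 * τ / 144, by nlinarith [mul_pos (pow_pos hδ₁ 2) hτ0], fun k μ hk hμ hap => ?_⟩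
  obtain ⟨hμ0, hμ⟩ := hμ
  have hint : ∀ s : ℝ, 0 < s → Integrable (fun z : ℝ × ℝ => Real.exp (-(s * z.1))) μ := fun s hs => (hμ s hs).1
  have hrep : ∀ t : ℝ, 0 < t → ∀ x : ℝ, k (mk2 t x) = ∫ z, Real.exp (-(z.1 * t)) * Real.cos (z.2 * x) ∂μ :=
    fun t ht x => (hμ t ht).2 x
  exact hasAperture_of_cosh_bound fun t ht => cosh_moment_step hτ0 hτ1 hδ₁ hδ₁1 hedge hk hμ0 hint hrep hap ht

end Summit.QuantumFields.YangMills.Theorems.F4SubCurvatureDoorPlanarApertureStepByName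

end
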